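import Summits.HodgeConjecture.HodgeConjecture.Theorems.WeilTypeLadderCyclicPrymThirteenQuartic
import Summits.HodgeConjecture.HodgeConjecture.Theorems.WeilTypeLadderCyclicPrymNineteenSextic
import Summits.HodgeConjecture.HodgeConjecture.Theorems.WeilTypeLadderCyclicPrymThirtyOneDecic
import Summits.HodgeConjecture.HodgeConjecture.Theorems.WeilTypeLadderCyclicPrymThirtySevenDuodecic
import Summits.HodgeConjecture.HodgeConjecture.Theorems.WeilTypeLadderCyclicPrymFortyThreeTetradecic
import Summits.HodgeConjecture.HodgeConjecture.Theorems.WeilTypeLadderFermatTwentyFour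
import Literature.AlgebraicGeometry.Deligne1982.WeilTypeCMHodgeRing
import Literature.AlgebraicGeometry.HodgeTheory.AlgebraicClassesCupAbelianVarietyDiagonal
import HarnessLib

/-!
# WeilTypeLadder · THE WHOLE HODGE RING of the very general twisted-triangle Prym: `HodgeConjectureFor B` from the
# `K′`-Weil classes (kernel shell of THEOREM HG (e), report `b2b-hweil-pv3-g45/GENERIC-HODGE-GROUP.md`)

b2b cell `hweil` (packet `run/shared/lean/b2b/hodge-weil/`). Setting of [P3-g43]/[P3-g44]: `p ≡ 1 (3)` prime, `E = ℚ(ζ_p)`,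
`H′ = C₃ ⊂ U = (ℤ/p)ˣ`, `K′ = E^{H′}` (CM of degree `(p−1)/3`), `β = τ ⊔ (−a)·τ` a TWISTED TRIANGLE (THEOREM TT), `B = J(C_b)`
the Jacobian (= `ζ_p`-primitive Prym) of the six-point `ℤ/p`-cover `y^p = ∏ (x − bᵢ)^{βᵢ}`, `dim B = 2(p−1)`, `θ = η − η̄`
the anti-invariant Gaussian-period generator of `K′` with minimal polynomial `P` (the tree's `…ThirteenQuartic`,
`…NineteenSextic`, `…ThirtyOneDecic`, `…ThirtySevenDuodecic`, `…FortyThreeTetradecic`).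

THEOREM HG of the report (pen-and-paper on refereed inputs — Rohde LNM 1975 Thm. 6.1.1/6.3.7 for the algebraic
monodromy, André/Moonen for `Mon⁰ ◁ MT^{der}`, the first fundamental theorem for `∏ SL₄` —; NOT in the tree, which has
no families): for `b` very general, `Hg(B_b) = {g ∈ U_E(H¹, φ) : det_E g ∈ T_f}` with `T_f ⊂ U_E(1)` the `ℚ`-torus of
cocharacter module `ℚ[U]·(D − 2)`, `dim T_f = (p−1)/3 − |Δ(τ)|`; `End⁰(B_b) = E`, `B_b` SIMPLE; and when the character
defect `Δ(τ)` is empty (all `(p−1)/6` families for every `p ≤ 61`; machine, exact, three implementations) the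
`ℚ`-algebra of Hodge classes of `B_b` is GENERATED BY THE DIVISOR CLASSES AND THE `K′`-WEIL CLASSES `W_{K′} ⊂ H¹²(B_b, ℚ)`
— in the tree's vocabulary: `hodgeClassSpan B.dim B.X q ≤ divisorWeilAlgebra B θ P (3n) q` for every `q`
(`Deligne1982.divisorWeilAlgebra` = the subalgebra generated by the rational `(1,1)`-classes and
`weilClassesField B θ P (6n) = W_{K′} ⊗ ℂ`). THIS FILE is the kernel composition of that statement (a HYPOTHESIS
`hgen`, binder) with the cell's transfer bodies: the `K′`-Weil classes are algebraic by the Fermat-triple transfer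
(`…_of_facts (hF₃ hP)`, [P3-g43] COROLLARY R3-CYC′), divisor classes by Lefschetz `(1,1)` (tree theorem), products by
the cup-closure of algebraic classes on abelian varieties (tree theorem `HodgeTheory.AbelianVariety.cupProduct_mem_algebraicClasses`,
Voisin II Prop. 9.20; packaged inline) — hence **`HodgeConjectureFor B.dim B.X`: the Hodge conjecture for `B` in every codimension.**

What is PROVED here (kernel): §1 the generic reduction `hodgeConjectureFor_of_hodgeClassSpan_le_divisorWeilAlgebra`
(any `(A, φ, P, k)`: `B• ⊗ ℂ ⊆ ⟨D•, W ⊗ ℂ⟩` + `W ⊗ ℂ ⊆ Nᵏ` ⟹ `HodgeConjectureFor A`) and its rational-points form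
`hodgeConjectureFor_of_divisorWeil_rational` (descent input `hQ` — `W ⊗ ℂ` spanned by its rational members, at one `(A, φ, P, 2k)` —,
Hodge type of the Weil classes `hH`, algebraicity of the RATIONAL Hodge Weil classes `hR`); the two auxiliary steps (cup-closure packaging from the Literature
theorem `AbelianVariety.cupProduct_mem_algebraicClasses`; rational span ⟹ complex subspace by `Submodule.span_le`) are INLINED, so that the
ladder imports only `Literature.*` and its own files (the cell's cross-link rule, referee-g166 R876–R878: no ring-2 module is imported) and no
landed declaration is restated (gate `dedup.landed`, p333594);
§2 the five instances `hodgeConjectureFor_cyclicPrym{Thirteen_quartic, Nineteen_sextic, ThirtyOne_decic,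
ThirtySeven_duodecic, FortyThree_tetradecic}_of_facts (hF₃ hP)` — binders: the `_of_facts` binders of the five
placement files (`B`, `s`, `n`, `Φ_p(s) = 0`, `dim B`, the Fermat triple and the datum `T, a, b`), the transfer
hypothesis `hdatum` for every class of `W_{K′} ⊗ ℂ` (PROPOSITION CYC′), `hQ`, `hH` (Moonen–Zarhin for `K′`-Weil `β`:
THEOREM W′/TT), `hgen` (THEOREM HG (d)); conclusion `HodgeConjectureFor B.dim B.X`; the on-path companion is the tree's
`hodgeConjectureFor_abelianVariety_of_hodgeConjecture` (the conclusion is a case of the summit). Case lines served: C27 (p = 13), C28 (19), C31 (31), C32 (37), C33 (43), at `n = 2`.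

HONEST LABEL: a SHELL — the geometry (datum, `K′`-Weil-ness, descent, the Hodge-ring generation for the VERY GENERAL
member) enters as explicit binders, exactly as in every placement file of this ladder; the named facts are Shioda 1979
Thm. 2 (three factors, `p` prime) and Fulton Cor. 19.2 (b), both refereed; nothing of [Mar25]/[Mos26]/[Perry];
Markman-free; no `sorry`, no new definition, no new named fact, no `decide`; default heartbeats. 0 unconditional rungs
above the floor: these are CASE loci (three-parameter families), not a rung.
-/

noncomputable section

set_option linter.dupNamespace false

open CategoryTheory MonoidalCategory Polynomial
open Literature.AlgebraicGeometry Literature.AlgebraicGeometry.Motives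
open Literature.AlgebraicGeometry.HodgeTheory
open Literature.AlgebraicGeometry.Deligne1982
open Literature.AlgebraicGeometry.VanGeemen1994 (hodgeClassSpan)
open Literature.AlgebraicTopology.SingularHomology

namespace Summit.HodgeConjecture.HodgeConjecture.WeilTypeLadder

/-! ### §1 The generic reduction: Hodge ring generated by divisors and `W ⊗ ℂ`, `W ⊗ ℂ` algebraic ⟹ `HodgeConjectureFor` -/

section Generic

/-- **`HodgeConjectureFor A` from a divisor–Weil generated Hodge ring.** For a complex abelian variety `A`, an
endomorphism `φ`, `P ∈ ℤ[T]`, `k ∈ ℕ`: if every rational `(q,q)`-class lies in `divisorWeilAlgebra A φ P k q` (the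
subalgebra of `H^{2•}(A(ℂ); ℂ)` generated by the rational `(1,1)`-classes and `weilClassesField A φ P (2k)`) and
`weilClassesField A φ P (2k) ⊆ Nᵏ`, then the Hodge conjecture holds for `A` in every codimension — divisor classes
are algebraic by Lefschetz `(1,1)` and the algebraic classes of an abelian variety are closed under cup product
(tree theorems). [cite: Deligne1982HodgeCycles, §4 (4.4) and Milne 2003 re-edition endnote 16]
[cite: VoisinHodgeII2003, Prop. 9.20] [cite: VoisinHodgeI2002, Thm. 11.30] -/
theorem hodgeConjectureFor_of_hodgeClassSpan_le_divisorWeilAlgebra (A : AbelianVariety ℂ) (φ : A ⟶ A)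
    (P : Polynomial ℤ) (k : ℕ)
    (hgen : ∀ q : ℕ, hodgeClassSpan A.dim A.X q ≤ divisorWeilAlgebra A φ P k q)
    (hW : weilClassesField A φ P (2 * k) ≤ algebraicClasses A.X k) :
    HodgeConjectureFor A.dim A.X :=
  ⟨nonempty_hodgeModel_holds (AbelianVariety.isSmoothProjective_holds (A := A)), fun q _ hc hqq =>
    divisorWeilAlgebra_le_algebraicClasses
      -- cup-closure of the algebraic classes of an abelian variety (Voisin II Prop. 9.20; tree theorem), packaged inline
      { one_mem := by
          show singularCohomology.one ℂ (ComplexPoints A.X) ∈ algebraicClasses A.X 0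
          rw [algebraicClasses_zero]
          exact Submodule.mem_top
        cup_mem := fun _ _ _ _ ha hb =>
          Literature.AlgebraicGeometry.HodgeTheory.AbelianVariety.cupProduct_mem_algebraicClasses A ha hb } hW q
      (hgen q (Submodule.subset_span ⟨hc, hqq⟩))⟩

/-- **Rational-points form.** The same conclusion from: `hgen`; the DESCENT input at `(A, φ, P, 2k)` (`W ⊗ ℂ` is
spanned by its rational members — in print part of the definition `W_F = ⋀_F H¹(A, ℚ)`); every member of `W ⊗ ℂ` is
of type `(k,k)` (Moonen–Zarhin's criterion for a Weil-type action); and the RATIONAL `(k,k)` members of `W ⊗ ℂ` are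
algebraic (what a transfer body delivers). [cite: MoonenZarhin1998WeilClasses, §1 (Criterion)]
[cite: vanGeemen1994HodgeAV, 4.9–4.10] [cite: Deligne1982HodgeCycles, Milne 2003 re-edition endnote 16] -/
theorem hodgeConjectureFor_of_divisorWeil_rational (A : AbelianVariety ℂ) (φ : A ⟶ A) (P : Polynomial ℤ) (k : ℕ)
    (hgen : ∀ q : ℕ, hodgeClassSpan A.dim A.X q ≤ divisorWeilAlgebra A φ P k q)
    (hQ : weilClassesField A φ P (2 * k) ≤
      Submodule.span ℂ {c | c ∈ weilClassesField A φ P (2 * k) ∧ IsRationalClass c})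
    (hH : ∀ c ∈ weilClassesField A φ P (2 * k), IsOfHodgeType A.dim A.X (2 * k) k k c)
    (hR : ∀ c ∈ weilClassesField A φ P (2 * k), IsRationalClass c →
      IsOfHodgeType A.dim A.X (2 * k) k k c → c ∈ algebraicClasses A.X k) :
    HodgeConjectureFor A.dim A.X :=
  hodgeConjectureFor_of_hodgeClassSpan_le_divisorWeilAlgebra A φ P k hgen
    (hQ.trans (Submodule.span_le.2 fun c hc ↦ hR c hc.1 hc.2 (hH c hc.1)))

/-! On-path companion (for §2 at once): every conclusion below is `HodgeConjectureFor B.dim B.X` for a complex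
abelian variety `B`, a CASE of the summit; the forward-contract lemma is the tree's
`hodgeConjectureFor_abelianVariety_of_hodgeConjecture` (`…WeilTypeLadderFermatTwentyFour`, imported; not re-declared). -/

/-- Sanity (on path): the summit gives the conclusion of every §2 theorem outright. [cite: Deligne2000, §1] -/
example (h : _root_.HodgeConjecture) (B : AbelianVariety ℂ) : HodgeConjectureFor B.dim B.X :=
  hodgeConjectureFor_abelianVariety_of_hodgeConjecture h B

end Generic

/-! ### §2 The five twisted-triangle rows: `HodgeConjectureFor B` from the Fermat-triple transfer + THEOREM HG (d) -/

section Instances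

/-- **THEOREM HG (e), kernel shell — p = 13 (quartic `K′ = ℚ(ζ₁₃)^{C₃}`; case line C27: the two families `(1,1,2,4,8,10)`, `(1,1,4,4,5,11)`, abelian `24`-folds at `n = 2`).**
For `B` with `s : B ⟶ B`, `Φ_13(s) = 0`, `dim B = 12n`, `θ = φ(s)` and `P` as in `…CyclicPrymThirteen…`, a Fermat-triple datum
(`X₁, X₂, X₃ = X^{2n}_13`, `T`, `a` surjective, `b`), GIVEN: (`hdatum`) every class of `W_{K′} ⊗ ℂ = weilClassesField B θ P (6n)`
pulls back into `⨆ᵢ bᵢ^*(span of the rational (3n,3n)-classes of the triple)` (PROPOSITION CYC′); (`hQ`) descent; (`hH`) the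
`K′`-Weil classes are of type `(3n,3n)` (THEOREM W′/TT + Moonen–Zarhin); (`hgen`) every rational Hodge class of `B` lies in
the algebra generated by divisor classes and `W_{K′} ⊗ ℂ` (THEOREM HG (d): the VERY GENERAL member, `Δ(τ) = ∅`) — THEN
`HodgeConjectureFor B.dim B.X`. [cite: Shioda1979PJA, §2 Thm. 2 (p. 112) with the list after Thm. 1]
[cite: Fulton1998, §19.2 Cor. 19.2 (b)] [cite: Rohde2009CyclicCoverings, Thm. 6.1.1 and Thm. 6.3.7]
[cite: MoonenZarhin1998WeilClasses, §1 (Criterion) and the Lemma on Gdiv(X) (3)] -/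
theorem hodgeConjectureFor_cyclicPrymThirteen_quartic_of_facts
    (hF₃ : hodgeClasses_algebraic_fermatProduct₃) (hP : fulton1998_map_mem_algebraicClasses) :
    ∀ (B : Motives.AbelianVariety ℂ) (s : B ⟶ B) (n : ℕ),
      Polynomial.eval₂ (Int.castRingHom (CategoryTheory.End B)) (s : CategoryTheory.End B)
        (Polynomial.cyclotomic 13 ℤ) = 0 → B.dim = 12 * n →
    ∀ (X₁ X₂ X₃ T : Motives.SchemeOver ℂ),
      IsFermatVariety (2 * n) 13 X₁ → IsSmoothProjective (2 * n) X₁ → IsFermatVariety (2 * n) 13 X₂ →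
      IsSmoothProjective (2 * n) X₂ → IsFermatVariety (2 * n) 13 X₃ → IsSmoothProjective (2 * n) X₃ →
      IsSmoothProjective B.dim T →
    ∀ (a : T ⟶ B.X), AlgebraicGeometry.Surjective a.left → ∀ (ι : Type) (b : ι → (T ⟶ (X₁ ⊗ X₂) ⊗ X₃)),
      (∀ c ∈ weilClassesField B
          (CategoryTheory.End.asHom (CategoryTheory.End.of s + CategoryTheory.End.of s ^ 3 + CategoryTheory.End.of s ^ 9 -
            CategoryTheory.End.of s ^ 4 - CategoryTheory.End.of s ^ 10 - CategoryTheory.End.of s ^ 12))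
          (X ^ 4 + 13 * X ^ 2 + 13 : Polynomial ℤ) (2 * (3 * n)),
        complexBetti.map a (2 * (3 * n)) c ∈ (⨆ i, (Submodule.span ℂ
            {x : complexBetti ((X₁ ⊗ X₂) ⊗ X₃) (2 * (3 * n)) |
              IsRationalClass x ∧ IsOfHodgeType (2 * n + 2 * n + 2 * n) ((X₁ ⊗ X₂) ⊗ X₃) (2 * (3 * n)) (3 * n) (3 * n) x}).map
              (complexBetti.map (b i) (2 * (3 * n))).hom)) →
      weilClassesField B
          (CategoryTheory.End.asHom (CategoryTheory.End.of s + CategoryTheory.End.of s ^ 3 + CategoryTheory.End.of s ^ 9 -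
            CategoryTheory.End.of s ^ 4 - CategoryTheory.End.of s ^ 10 - CategoryTheory.End.of s ^ 12))
          (X ^ 4 + 13 * X ^ 2 + 13 : Polynomial ℤ) (2 * (3 * n)) ≤
        Submodule.span ℂ {c | c ∈ weilClassesField B
          (CategoryTheory.End.asHom (CategoryTheory.End.of s + CategoryTheory.End.of s ^ 3 + CategoryTheory.End.of s ^ 9 -
            CategoryTheory.End.of s ^ 4 - CategoryTheory.End.of s ^ 10 - CategoryTheory.End.of s ^ 12))
          (X ^ 4 + 13 * X ^ 2 + 13 : Polynomial ℤ) (2 * (3 * n)) ∧ IsRationalClass c} →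
      (∀ c ∈ weilClassesField B
          (CategoryTheory.End.asHom (CategoryTheory.End.of s + CategoryTheory.End.of s ^ 3 + CategoryTheory.End.of s ^ 9 -
            CategoryTheory.End.of s ^ 4 - CategoryTheory.End.of s ^ 10 - CategoryTheory.End.of s ^ 12))
          (X ^ 4 + 13 * X ^ 2 + 13 : Polynomial ℤ) (2 * (3 * n)),
        IsOfHodgeType B.dim B.X (2 * (3 * n)) (3 * n) (3 * n) c) →
      (∀ q : ℕ, hodgeClassSpan B.dim B.X q ≤ divisorWeilAlgebra B
          (CategoryTheory.End.asHom (CategoryTheory.End.of s + CategoryTheory.End.of s ^ 3 + CategoryTheory.End.of s ^ 9 -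
            CategoryTheory.End.of s ^ 4 - CategoryTheory.End.of s ^ 10 - CategoryTheory.End.of s ^ 12))
          (X ^ 4 + 13 * X ^ 2 + 13 : Polynomial ℤ) (3 * n) q) →
      HodgeConjectureFor B.dim B.X := by
  intro B s n hs hdim X₁ X₂ X₃ T hF₁' hX₁ hF₂' hX₂ hF₃' hX₃ hT a ha ι b hdatum hQ hH hgen
  exact hodgeConjectureFor_of_divisorWeil_rational B _ _ (3 * n) hgen hQ hH
    (fun c hcW hc hmm => weilClassesCMField_cyclicPrymThirteen_quartic_of_facts hF₃ hP B s n hs hdim X₁ X₂ X₃ T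
      hF₁' hX₁ hF₂' hX₂ hF₃' hX₃ hT a ha ι b c hcW (hdatum c hcW) hc hmm)

/-- **THEOREM HG (e), kernel shell — p = 19 (sextic `K′ = ℚ(ζ₁₉)^{C₃}`; case line C28: the three families `(1,1,3,8,8,17)`, `(1,1,6,8,10,12)`, `(1,2,5,8,9,13)`, abelian `36`-folds at `n = 2`).**
For `B` with `s : B ⟶ B`, `Φ_19(s) = 0`, `dim B = 18n`, `θ = φ(s)` and `P` as in `…CyclicPrymNineteen…`, a Fermat-triple datum
(`X₁, X₂, X₃ = X^{2n}_19`, `T`, `a` surjective, `b`), GIVEN: (`hdatum`) every class of `W_{K′} ⊗ ℂ = weilClassesField B θ P (6n)`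
pulls back into `⨆ᵢ bᵢ^*(span of the rational (3n,3n)-classes of the triple)` (PROPOSITION CYC′); (`hQ`) descent; (`hH`) the
`K′`-Weil classes are of type `(3n,3n)` (THEOREM W′/TT + Moonen–Zarhin); (`hgen`) every rational Hodge class of `B` lies in
the algebra generated by divisor classes and `W_{K′} ⊗ ℂ` (THEOREM HG (d): the VERY GENERAL member, `Δ(τ) = ∅`) — THEN
`HodgeConjectureFor B.dim B.X`. [cite: Shioda1979PJA, §2 Thm. 2 (p. 112) with the list after Thm. 1]
[cite: Fulton1998, §19.2 Cor. 19.2 (b)] [cite: Rohde2009CyclicCoverings, Thm. 6.1.1 and Thm. 6.3.7]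
[cite: MoonenZarhin1998WeilClasses, §1 (Criterion) and the Lemma on Gdiv(X) (3)] -/
theorem hodgeConjectureFor_cyclicPrymNineteen_sextic_of_facts
    (hF₃ : hodgeClasses_algebraic_fermatProduct₃) (hP : fulton1998_map_mem_algebraicClasses) :
    ∀ (B : Motives.AbelianVariety ℂ) (s : B ⟶ B) (n : ℕ),
      Polynomial.eval₂ (Int.castRingHom (CategoryTheory.End B)) (s : CategoryTheory.End B)
        (Polynomial.cyclotomic 19 ℤ) = 0 → B.dim = 18 * n →
    ∀ (X₁ X₂ X₃ T : Motives.SchemeOver ℂ),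
      IsFermatVariety (2 * n) 19 X₁ → IsSmoothProjective (2 * n) X₁ → IsFermatVariety (2 * n) 19 X₂ →
      IsSmoothProjective (2 * n) X₂ → IsFermatVariety (2 * n) 19 X₃ → IsSmoothProjective (2 * n) X₃ →
      IsSmoothProjective B.dim T →
    ∀ (a : T ⟶ B.X), AlgebraicGeometry.Surjective a.left → ∀ (ι : Type) (b : ι → (T ⟶ (X₁ ⊗ X₂) ⊗ X₃)),
      (∀ c ∈ weilClassesField B
          (CategoryTheory.End.asHom (CategoryTheory.End.of s + CategoryTheory.End.of s ^ 7 + CategoryTheory.End.of s ^ 11 -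
            CategoryTheory.End.of s ^ 8 - CategoryTheory.End.of s ^ 12 - CategoryTheory.End.of s ^ 18))
          (X ^ 6 + 19 * X ^ 4 + 38 * X ^ 2 + 19 : Polynomial ℤ) (2 * (3 * n)),
        complexBetti.map a (2 * (3 * n)) c ∈ (⨆ i, (Submodule.span ℂ
            {x : complexBetti ((X₁ ⊗ X₂) ⊗ X₃) (2 * (3 * n)) |
              IsRationalClass x ∧ IsOfHodgeType (2 * n + 2 * n + 2 * n) ((X₁ ⊗ X₂) ⊗ X₃) (2 * (3 * n)) (3 * n) (3 * n) x}).map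
              (complexBetti.map (b i) (2 * (3 * n))).hom)) →
      weilClassesField B
          (CategoryTheory.End.asHom (CategoryTheory.End.of s + CategoryTheory.End.of s ^ 7 + CategoryTheory.End.of s ^ 11 -
            CategoryTheory.End.of s ^ 8 - CategoryTheory.End.of s ^ 12 - CategoryTheory.End.of s ^ 18))
          (X ^ 6 + 19 * X ^ 4 + 38 * X ^ 2 + 19 : Polynomial ℤ) (2 * (3 * n)) ≤
        Submodule.span ℂ {c | c ∈ weilClassesField B
          (CategoryTheory.End.asHom (CategoryTheory.End.of s + CategoryTheory.End.of s ^ 7 + CategoryTheory.End.of s ^ 11 -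
            CategoryTheory.End.of s ^ 8 - CategoryTheory.End.of s ^ 12 - CategoryTheory.End.of s ^ 18))
          (X ^ 6 + 19 * X ^ 4 + 38 * X ^ 2 + 19 : Polynomial ℤ) (2 * (3 * n)) ∧ IsRationalClass c} →
      (∀ c ∈ weilClassesField B
          (CategoryTheory.End.asHom (CategoryTheory.End.of s + CategoryTheory.End.of s ^ 7 + CategoryTheory.End.of s ^ 11 -
            CategoryTheory.End.of s ^ 8 - CategoryTheory.End.of s ^ 12 - CategoryTheory.End.of s ^ 18))
          (X ^ 6 + 19 * X ^ 4 + 38 * X ^ 2 + 19 : Polynomial ℤ) (2 * (3 * n)),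
        IsOfHodgeType B.dim B.X (2 * (3 * n)) (3 * n) (3 * n) c) →
      (∀ q : ℕ, hodgeClassSpan B.dim B.X q ≤ divisorWeilAlgebra B
          (CategoryTheory.End.asHom (CategoryTheory.End.of s + CategoryTheory.End.of s ^ 7 + CategoryTheory.End.of s ^ 11 -
            CategoryTheory.End.of s ^ 8 - CategoryTheory.End.of s ^ 12 - CategoryTheory.End.of s ^ 18))
          (X ^ 6 + 19 * X ^ 4 + 38 * X ^ 2 + 19 : Polynomial ℤ) (3 * n) q) →
      HodgeConjectureFor B.dim B.X := by
  intro B s n hs hdim X₁ X₂ X₃ T hF₁' hX₁ hF₂' hX₂ hF₃' hX₃ hT a ha ι b hdatum hQ hH hgen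
  exact hodgeConjectureFor_of_divisorWeil_rational B _ _ (3 * n) hgen hQ hH
    (fun c hcW hc hmm => weilClassesCMField_cyclicPrymNineteen_sextic_of_facts hF₃ hP B s n hs hdim X₁ X₂ X₃ T
      hF₁' hX₁ hF₂' hX₂ hF₃' hX₃ hT a ha ι b c hcW (hdatum c hcW) hc hmm)

/-- **THEOREM HG (e), kernel shell — p = 31 (decic `K′ = ℚ(ζ₃₁)^{C₃}`; case line C31: the five families of [P3-g44] 5.4, abelian `60`-folds at `n = 2`).**
For `B` with `s : B ⟶ B`, `Φ_31(s) = 0`, `dim B = 30n`, `θ = φ(s)` and `P` as in `…CyclicPrymThirtyOne…`, a Fermat-triple datum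
(`X₁, X₂, X₃ = X^{2n}_31`, `T`, `a` surjective, `b`), GIVEN: (`hdatum`) every class of `W_{K′} ⊗ ℂ = weilClassesField B θ P (6n)`
pulls back into `⨆ᵢ bᵢ^*(span of the rational (3n,3n)-classes of the triple)` (PROPOSITION CYC′); (`hQ`) descent; (`hH`) the
`K′`-Weil classes are of type `(3n,3n)` (THEOREM W′/TT + Moonen–Zarhin); (`hgen`) every rational Hodge class of `B` lies in
the algebra generated by divisor classes and `W_{K′} ⊗ ℂ` (THEOREM HG (d): the VERY GENERAL member, `Δ(τ) = ∅`) — THEN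
`HodgeConjectureFor B.dim B.X`. [cite: Shioda1979PJA, §2 Thm. 2 (p. 112) with the list after Thm. 1]
[cite: Fulton1998, §19.2 Cor. 19.2 (b)] [cite: Rohde2009CyclicCoverings, Thm. 6.1.1 and Thm. 6.3.7]
[cite: MoonenZarhin1998WeilClasses, §1 (Criterion) and the Lemma on Gdiv(X) (3)] -/
theorem hodgeConjectureFor_cyclicPrymThirtyOne_decic_of_facts
    (hF₃ : hodgeClasses_algebraic_fermatProduct₃) (hP : fulton1998_map_mem_algebraicClasses) :
    ∀ (B : Motives.AbelianVariety ℂ) (s : B ⟶ B) (n : ℕ),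
      Polynomial.eval₂ (Int.castRingHom (CategoryTheory.End B)) (s : CategoryTheory.End B)
        (Polynomial.cyclotomic 31 ℤ) = 0 → B.dim = 30 * n →
    ∀ (X₁ X₂ X₃ T : Motives.SchemeOver ℂ),
      IsFermatVariety (2 * n) 31 X₁ → IsSmoothProjective (2 * n) X₁ → IsFermatVariety (2 * n) 31 X₂ →
      IsSmoothProjective (2 * n) X₂ → IsFermatVariety (2 * n) 31 X₃ → IsSmoothProjective (2 * n) X₃ →
      IsSmoothProjective B.dim T →
    ∀ (a : T ⟶ B.X), AlgebraicGeometry.Surjective a.left → ∀ (ι : Type) (b : ι → (T ⟶ (X₁ ⊗ X₂) ⊗ X₃)),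
      (∀ c ∈ weilClassesField B
          (CategoryTheory.End.asHom (CategoryTheory.End.of s + CategoryTheory.End.of s ^ 5 + CategoryTheory.End.of s ^ 25 - CategoryTheory.End.of s ^ 6 - CategoryTheory.End.of s ^ 26 - CategoryTheory.End.of s ^ 30))
          (X ^ 10 + 31 * X ^ 8 + 248 * X ^ 6 + 713 * X ^ 4 + 651 * X ^ 2 + 31 : Polynomial ℤ) (2 * (3 * n)),
        complexBetti.map a (2 * (3 * n)) c ∈ (⨆ i, (Submodule.span ℂ
            {x : complexBetti ((X₁ ⊗ X₂) ⊗ X₃) (2 * (3 * n)) |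
              IsRationalClass x ∧ IsOfHodgeType (2 * n + 2 * n + 2 * n) ((X₁ ⊗ X₂) ⊗ X₃) (2 * (3 * n)) (3 * n) (3 * n) x}).map
              (complexBetti.map (b i) (2 * (3 * n))).hom)) →
      weilClassesField B
          (CategoryTheory.End.asHom (CategoryTheory.End.of s + CategoryTheory.End.of s ^ 5 + CategoryTheory.End.of s ^ 25 - CategoryTheory.End.of s ^ 6 - CategoryTheory.End.of s ^ 26 - CategoryTheory.End.of s ^ 30))
          (X ^ 10 + 31 * X ^ 8 + 248 * X ^ 6 + 713 * X ^ 4 + 651 * X ^ 2 + 31 : Polynomial ℤ) (2 * (3 * n)) ≤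
        Submodule.span ℂ {c | c ∈ weilClassesField B
          (CategoryTheory.End.asHom (CategoryTheory.End.of s + CategoryTheory.End.of s ^ 5 + CategoryTheory.End.of s ^ 25 - CategoryTheory.End.of s ^ 6 - CategoryTheory.End.of s ^ 26 - CategoryTheory.End.of s ^ 30))
          (X ^ 10 + 31 * X ^ 8 + 248 * X ^ 6 + 713 * X ^ 4 + 651 * X ^ 2 + 31 : Polynomial ℤ) (2 * (3 * n)) ∧ IsRationalClass c} →
      (∀ c ∈ weilClassesField B
          (CategoryTheory.End.asHom (CategoryTheory.End.of s + CategoryTheory.End.of s ^ 5 + CategoryTheory.End.of s ^ 25 - CategoryTheory.End.of s ^ 6 - CategoryTheory.End.of s ^ 26 - CategoryTheory.End.of s ^ 30))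
          (X ^ 10 + 31 * X ^ 8 + 248 * X ^ 6 + 713 * X ^ 4 + 651 * X ^ 2 + 31 : Polynomial ℤ) (2 * (3 * n)),
        IsOfHodgeType B.dim B.X (2 * (3 * n)) (3 * n) (3 * n) c) →
      (∀ q : ℕ, hodgeClassSpan B.dim B.X q ≤ divisorWeilAlgebra B
          (CategoryTheory.End.asHom (CategoryTheory.End.of s + CategoryTheory.End.of s ^ 5 + CategoryTheory.End.of s ^ 25 - CategoryTheory.End.of s ^ 6 - CategoryTheory.End.of s ^ 26 - CategoryTheory.End.of s ^ 30))
          (X ^ 10 + 31 * X ^ 8 + 248 * X ^ 6 + 713 * X ^ 4 + 651 * X ^ 2 + 31 : Polynomial ℤ) (3 * n) q) →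
      HodgeConjectureFor B.dim B.X := by
  intro B s n hs hdim X₁ X₂ X₃ T hF₁' hX₁ hF₂' hX₂ hF₃' hX₃ hT a ha ι b hdatum hQ hH hgen
  exact hodgeConjectureFor_of_divisorWeil_rational B _ _ (3 * n) hgen hQ hH
    (fun c hcW hc hmm => weilClassesCMField_cyclicPrymThirtyOne_decic_of_facts hF₃ hP B s n hs hdim X₁ X₂ X₃ T
      hF₁' hX₁ hF₂' hX₂ hF₃' hX₃ hT a ha ι b c hcW (hdatum c hcW) hc hmm)

/-- **THEOREM HG (e), kernel shell — p = 37 (duodecic `K′ = ℚ(ζ₃₇)^{C₃}`; case line C32: the six families of [P3-g44] 5.4, abelian `72`-folds at `n = 2`).**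
For `B` with `s : B ⟶ B`, `Φ_37(s) = 0`, `dim B = 36n`, `θ = φ(s)` and `P` as in `…CyclicPrymThirtySeven…`, a Fermat-triple datum
(`X₁, X₂, X₃ = X^{2n}_37`, `T`, `a` surjective, `b`), GIVEN: (`hdatum`) every class of `W_{K′} ⊗ ℂ = weilClassesField B θ P (6n)`
pulls back into `⨆ᵢ bᵢ^*(span of the rational (3n,3n)-classes of the triple)` (PROPOSITION CYC′); (`hQ`) descent; (`hH`) the
`K′`-Weil classes are of type `(3n,3n)` (THEOREM W′/TT + Moonen–Zarhin); (`hgen`) every rational Hodge class of `B` lies in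
the algebra generated by divisor classes and `W_{K′} ⊗ ℂ` (THEOREM HG (d): the VERY GENERAL member, `Δ(τ) = ∅`) — THEN
`HodgeConjectureFor B.dim B.X`. [cite: Shioda1979PJA, §2 Thm. 2 (p. 112) with the list after Thm. 1]
[cite: Fulton1998, §19.2 Cor. 19.2 (b)] [cite: Rohde2009CyclicCoverings, Thm. 6.1.1 and Thm. 6.3.7]
[cite: MoonenZarhin1998WeilClasses, §1 (Criterion) and the Lemma on Gdiv(X) (3)] -/
theorem hodgeConjectureFor_cyclicPrymThirtySeven_duodecic_of_facts
    (hF₃ : hodgeClasses_algebraic_fermatProduct₃) (hP : fulton1998_map_mem_algebraicClasses) :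
    ∀ (B : Motives.AbelianVariety ℂ) (s : B ⟶ B) (n : ℕ),
      Polynomial.eval₂ (Int.castRingHom (CategoryTheory.End B)) (s : CategoryTheory.End B)
        (Polynomial.cyclotomic 37 ℤ) = 0 → B.dim = 36 * n →
    ∀ (X₁ X₂ X₃ T : Motives.SchemeOver ℂ),
      IsFermatVariety (2 * n) 37 X₁ → IsSmoothProjective (2 * n) X₁ → IsFermatVariety (2 * n) 37 X₂ →
      IsSmoothProjective (2 * n) X₂ → IsFermatVariety (2 * n) 37 X₃ → IsSmoothProjective (2 * n) X₃ →
      IsSmoothProjective B.dim T →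
    ∀ (a : T ⟶ B.X), AlgebraicGeometry.Surjective a.left → ∀ (ι : Type) (b : ι → (T ⟶ (X₁ ⊗ X₂) ⊗ X₃)),
      (∀ c ∈ weilClassesField B
          (CategoryTheory.End.asHom (CategoryTheory.End.of s + CategoryTheory.End.of s ^ 10 + CategoryTheory.End.of s ^ 26 - CategoryTheory.End.of s ^ 11 - CategoryTheory.End.of s ^ 27 - CategoryTheory.End.of s ^ 36))
          (X ^ 12 + 37 * X ^ 10 + 407 * X ^ 8 + 1628 * X ^ 6 + 2035 * X ^ 4 + 518 * X ^ 2 + 37 : Polynomial ℤ) (2 * (3 * n)),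
        complexBetti.map a (2 * (3 * n)) c ∈ (⨆ i, (Submodule.span ℂ
            {x : complexBetti ((X₁ ⊗ X₂) ⊗ X₃) (2 * (3 * n)) |
              IsRationalClass x ∧ IsOfHodgeType (2 * n + 2 * n + 2 * n) ((X₁ ⊗ X₂) ⊗ X₃) (2 * (3 * n)) (3 * n) (3 * n) x}).map
              (complexBetti.map (b i) (2 * (3 * n))).hom)) →
      weilClassesField B
          (CategoryTheory.End.asHom (CategoryTheory.End.of s + CategoryTheory.End.of s ^ 10 + CategoryTheory.End.of s ^ 26 - CategoryTheory.End.of s ^ 11 - CategoryTheory.End.of s ^ 27 - CategoryTheory.End.of s ^ 36))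
          (X ^ 12 + 37 * X ^ 10 + 407 * X ^ 8 + 1628 * X ^ 6 + 2035 * X ^ 4 + 518 * X ^ 2 + 37 : Polynomial ℤ) (2 * (3 * n)) ≤
        Submodule.span ℂ {c | c ∈ weilClassesField B
          (CategoryTheory.End.asHom (CategoryTheory.End.of s + CategoryTheory.End.of s ^ 10 + CategoryTheory.End.of s ^ 26 - CategoryTheory.End.of s ^ 11 - CategoryTheory.End.of s ^ 27 - CategoryTheory.End.of s ^ 36))
          (X ^ 12 + 37 * X ^ 10 + 407 * X ^ 8 + 1628 * X ^ 6 + 2035 * X ^ 4 + 518 * X ^ 2 + 37 : Polynomial ℤ) (2 * (3 * n)) ∧ IsRationalClass c} →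
      (∀ c ∈ weilClassesField B
          (CategoryTheory.End.asHom (CategoryTheory.End.of s + CategoryTheory.End.of s ^ 10 + CategoryTheory.End.of s ^ 26 - CategoryTheory.End.of s ^ 11 - CategoryTheory.End.of s ^ 27 - CategoryTheory.End.of s ^ 36))
          (X ^ 12 + 37 * X ^ 10 + 407 * X ^ 8 + 1628 * X ^ 6 + 2035 * X ^ 4 + 518 * X ^ 2 + 37 : Polynomial ℤ) (2 * (3 * n)),
        IsOfHodgeType B.dim B.X (2 * (3 * n)) (3 * n) (3 * n) c) →
      (∀ q : ℕ, hodgeClassSpan B.dim B.X q ≤ divisorWeilAlgebra B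
          (CategoryTheory.End.asHom (CategoryTheory.End.of s + CategoryTheory.End.of s ^ 10 + CategoryTheory.End.of s ^ 26 - CategoryTheory.End.of s ^ 11 - CategoryTheory.End.of s ^ 27 - CategoryTheory.End.of s ^ 36))
          (X ^ 12 + 37 * X ^ 10 + 407 * X ^ 8 + 1628 * X ^ 6 + 2035 * X ^ 4 + 518 * X ^ 2 + 37 : Polynomial ℤ) (3 * n) q) →
      HodgeConjectureFor B.dim B.X := by
  intro B s n hs hdim X₁ X₂ X₃ T hF₁' hX₁ hF₂' hX₂ hF₃' hX₃ hT a ha ι b hdatum hQ hH hgen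
  exact hodgeConjectureFor_of_divisorWeil_rational B _ _ (3 * n) hgen hQ hH
    (fun c hcW hc hmm => weilClassesCMField_cyclicPrymThirtySeven_duodecic_of_facts hF₃ hP B s n hs hdim X₁ X₂ X₃ T
      hF₁' hX₁ hF₂' hX₂ hF₃' hX₃ hT a ha ι b c hcW (hdatum c hcW) hc hmm)

/-- **THEOREM HG (e), kernel shell — p = 43 (tetradecic `K′ = ℚ(ζ₄₃)^{C₃}`; case line C33: the seven families of [P3-g44] 5.4, abelian `84`-folds at `n = 2`).**
For `B` with `s : B ⟶ B`, `Φ_43(s) = 0`, `dim B = 42n`, `θ = φ(s)` and `P` as in `…CyclicPrymFortyThree…`, a Fermat-triple datum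
(`X₁, X₂, X₃ = X^{2n}_43`, `T`, `a` surjective, `b`), GIVEN: (`hdatum`) every class of `W_{K′} ⊗ ℂ = weilClassesField B θ P (6n)`
pulls back into `⨆ᵢ bᵢ^*(span of the rational (3n,3n)-classes of the triple)` (PROPOSITION CYC′); (`hQ`) descent; (`hH`) the
`K′`-Weil classes are of type `(3n,3n)` (THEOREM W′/TT + Moonen–Zarhin); (`hgen`) every rational Hodge class of `B` lies in
the algebra generated by divisor classes and `W_{K′} ⊗ ℂ` (THEOREM HG (d): the VERY GENERAL member, `Δ(τ) = ∅`) — THEN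
`HodgeConjectureFor B.dim B.X`. [cite: Shioda1979PJA, §2 Thm. 2 (p. 112) with the list after Thm. 1]
[cite: Fulton1998, §19.2 Cor. 19.2 (b)] [cite: Rohde2009CyclicCoverings, Thm. 6.1.1 and Thm. 6.3.7]
[cite: MoonenZarhin1998WeilClasses, §1 (Criterion) and the Lemma on Gdiv(X) (3)] -/
theorem hodgeConjectureFor_cyclicPrymFortyThree_tetradecic_of_facts
    (hF₃ : hodgeClasses_algebraic_fermatProduct₃) (hP : fulton1998_map_mem_algebraicClasses) :
    ∀ (B : Motives.AbelianVariety ℂ) (s : B ⟶ B) (n : ℕ),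
      Polynomial.eval₂ (Int.castRingHom (CategoryTheory.End B)) (s : CategoryTheory.End B)
        (Polynomial.cyclotomic 43 ℤ) = 0 → B.dim = 42 * n →
    ∀ (X₁ X₂ X₃ T : Motives.SchemeOver ℂ),
      IsFermatVariety (2 * n) 43 X₁ → IsSmoothProjective (2 * n) X₁ → IsFermatVariety (2 * n) 43 X₂ →
      IsSmoothProjective (2 * n) X₂ → IsFermatVariety (2 * n) 43 X₃ → IsSmoothProjective (2 * n) X₃ →
      IsSmoothProjective B.dim T →
    ∀ (a : T ⟶ B.X), AlgebraicGeometry.Surjective a.left → ∀ (ι : Type) (b : ι → (T ⟶ (X₁ ⊗ X₂) ⊗ X₃)),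
      (∀ c ∈ weilClassesField B
          (CategoryTheory.End.asHom (CategoryTheory.End.of s + CategoryTheory.End.of s ^ 6 + CategoryTheory.End.of s ^ 36 - CategoryTheory.End.of s ^ 7 - CategoryTheory.End.of s ^ 37 - CategoryTheory.End.of s ^ 42))
          (X ^ 14 + 43 * X ^ 12 + 602 * X ^ 10 + 3397 * X ^ 8 + 8514 * X ^ 6 + 9030 * X ^ 4 + 3053 * X ^ 2 + 43 : Polynomial ℤ) (2 * (3 * n)),
        complexBetti.map a (2 * (3 * n)) c ∈ (⨆ i, (Submodule.span ℂ
            {x : complexBetti ((X₁ ⊗ X₂) ⊗ X₃) (2 * (3 * n)) |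
              IsRationalClass x ∧ IsOfHodgeType (2 * n + 2 * n + 2 * n) ((X₁ ⊗ X₂) ⊗ X₃) (2 * (3 * n)) (3 * n) (3 * n) x}).map
              (complexBetti.map (b i) (2 * (3 * n))).hom)) →
      weilClassesField B
          (CategoryTheory.End.asHom (CategoryTheory.End.of s + CategoryTheory.End.of s ^ 6 + CategoryTheory.End.of s ^ 36 - CategoryTheory.End.of s ^ 7 - CategoryTheory.End.of s ^ 37 - CategoryTheory.End.of s ^ 42))
          (X ^ 14 + 43 * X ^ 12 + 602 * X ^ 10 + 3397 * X ^ 8 + 8514 * X ^ 6 + 9030 * X ^ 4 + 3053 * X ^ 2 + 43 : Polynomial ℤ) (2 * (3 * n)) ≤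
        Submodule.span ℂ {c | c ∈ weilClassesField B
          (CategoryTheory.End.asHom (CategoryTheory.End.of s + CategoryTheory.End.of s ^ 6 + CategoryTheory.End.of s ^ 36 - CategoryTheory.End.of s ^ 7 - CategoryTheory.End.of s ^ 37 - CategoryTheory.End.of s ^ 42))
          (X ^ 14 + 43 * X ^ 12 + 602 * X ^ 10 + 3397 * X ^ 8 + 8514 * X ^ 6 + 9030 * X ^ 4 + 3053 * X ^ 2 + 43 : Polynomial ℤ) (2 * (3 * n)) ∧ IsRationalClass c} →
      (∀ c ∈ weilClassesField B
          (CategoryTheory.End.asHom (CategoryTheory.End.of s + CategoryTheory.End.of s ^ 6 + CategoryTheory.End.of s ^ 36 - CategoryTheory.End.of s ^ 7 - CategoryTheory.End.of s ^ 37 - CategoryTheory.End.of s ^ 42))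
          (X ^ 14 + 43 * X ^ 12 + 602 * X ^ 10 + 3397 * X ^ 8 + 8514 * X ^ 6 + 9030 * X ^ 4 + 3053 * X ^ 2 + 43 : Polynomial ℤ) (2 * (3 * n)),
        IsOfHodgeType B.dim B.X (2 * (3 * n)) (3 * n) (3 * n) c) →
      (∀ q : ℕ, hodgeClassSpan B.dim B.X q ≤ divisorWeilAlgebra B
          (CategoryTheory.End.asHom (CategoryTheory.End.of s + CategoryTheory.End.of s ^ 6 + CategoryTheory.End.of s ^ 36 - CategoryTheory.End.of s ^ 7 - CategoryTheory.End.of s ^ 37 - CategoryTheory.End.of s ^ 42))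
          (X ^ 14 + 43 * X ^ 12 + 602 * X ^ 10 + 3397 * X ^ 8 + 8514 * X ^ 6 + 9030 * X ^ 4 + 3053 * X ^ 2 + 43 : Polynomial ℤ) (3 * n) q) →
      HodgeConjectureFor B.dim B.X := by
  intro B s n hs hdim X₁ X₂ X₃ T hF₁' hX₁ hF₂' hX₂ hF₃' hX₃ hT a ha ι b hdatum hQ hH hgen
  exact hodgeConjectureFor_of_divisorWeil_rational B _ _ (3 * n) hgen hQ hH
    (fun c hcW hc hmm => weilClassesCMField_cyclicPrymFortyThree_tetradecic_of_facts hF₃ hP B s n hs hdim X₁ X₂ X₃ T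
      hF₁' hX₁ hF₂' hX₂ hF₃' hX₃ hT a ha ι b c hcW (hdatum c hcW) hc hmm)

end Instances

end Summit.HodgeConjecture.HodgeConjecture.WeilTypeLadder

end
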